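import Summits.Langlands.Langlands.Theorems.IrreducibilityBySelfDualityReciprocityUpToIrreducibilityCorrespondsConj
import HarnessLib

/-!
# Candidate proof for the child `AvatarConjugacy` (U = item stmt-Langlands-17844) of the split of
`FifteenLocusEisenstein.SectorComplement` (stmt-Langlands-16058)

U is PROVABLE NOW: one line from the landed `ReciprocityUpToIrreducibility.isConjugate_of_satakeFrobCompatibleAt` (p119850;
Chebotarev + Brauer–Nesbitt + irreducibility transfer, Deligne–Serre Lemme 3.2).  NOT landed by this seat: (i) planners cannot
propose into Theorems; (ii) COORDINATION CONSTRAINT inherited from route PrimeSwitchSplit (note on stmt-Langlands-17844,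
2026-08-17T02:18Z): the module proving it imports `TunnellLemma` / `JacquetLanglandsParts` through `chebotarev_artinRep`, so
closing the item today would drag that cone into every route file wanting it via the `_holds` link — wait for the
import-hygiene refactor wi-37501, then land THIS file (or its 3-line body) as `Theorems/<Route>AvatarConjugacy.lean`.
-/

noncomputable section

set_option linter.dupNamespace false

open scoped NumberField Classical
open Filter IsDedekindDomain
open Literature.NumberTheory.Automorphic Literature.NumberTheory.GaloisRepresentations
open Summit.Langlands

namespace Summit.Langlands.Langlands.Cruxes.SectorComplement.Birth16058AvatarConjugacy

/-- **U — the irreducible Satake avatar is unique up to conjugacy** (text of item stmt-Langlands-17844 verbatim).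
[cite: DeligneSerreASENS1974, Lemme 3.2] -/
theorem avatarConjugacy_proof : ∀ (K : Type) [Field K] [NumberField K] (n : ℕ) (hcpt : Literature.NumberTheory.Automorphic.isCompact_glFiniteIntegralLevel n K) (π : Literature.NumberTheory.Automorphic.CuspidalAutomorphicRepData n K hcpt) (ℓ : ℕ) [Fact ℓ.Prime] (ι : PadicAlgCl ℓ ≃+* ℂ) (ρ₀ ρ : Literature.NumberTheory.GaloisRepresentations.FramedGaloisRep K (PadicAlgCl ℓ) n), ρ₀.toGaloisRep.IsIrreducible → (∀ᶠ v : IsDedekindDomain.HeightOneSpectrum (NumberField.RingOfIntegers K) in Filter.cofinite, Summit.Langlands.SatakeFrobCompatibleAt ι π.1 ρ₀ v) → (∀ᶠ v : IsDedekindDomain.HeightOneSpectrum (NumberField.RingOfIntegers K) in Filter.cofinite, Summit.Langlands.SatakeFrobCompatibleAt ι π.1 ρ v) → Summit.Langlands.IsConjugate ρ₀ ρ :=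
  fun _ _ _ _ _ π _ _ ι _ _ h₀ h₁ h₂ =>
    Summit.Langlands.Langlands.Theorems.ReciprocityUpToIrreducibility.isConjugate_of_satakeFrobCompatibleAt π.1 ι h₀ h₁ h₂

end Summit.Langlands.Langlands.Cruxes.SectorComplement.Birth16058AvatarConjugacy

end
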